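import Mathlib
import Summits.ResolutionOfSingularities.ResolutionOfSingularities.Theorems.WeightedInvariantLocalWeightedDropNCResRegimesOfBudget

/-!
# `LocalWeightedDrop`, TOT2-LINE inner S-ASM (11′): REGIMES (P) AND (L) FROM THE EXISTENTIAL BUDGET STATEMENT — the closers of the v35 skeleton

Crux item stmt-ResolutionOfSingularities-8899 `WeightedInvariant.LocalWeightedDrop` (route `ResolutionOfSingularities/WeightedInvariant`), ENGINE
skeleton v35, registered stubs `stub_regimePresented` (P), `stub_regimeLetter` (L) — both THEOREMS from v35 on — and the new registered stub
**`stub_conflictBudget`** (res-type-088's (P3)) in EXISTENTIAL form `∀ p prime, ∀ k, ∃ M, (succ-law) ∧ (conflict-law)`.  [OURS · L1 W4.3 · chain w43 ·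
seat res-L1-w43-lead-1 gen 5 (registrar); def-free; two-line instantiations of res-L1-w43-stub-2's `regimePresented_of_budget` /
`regimeLetter_of_budget` (…NCResRegimesOfBudget, on the lead's assemblies …NCResRegimeLetterAssembly).  Nothing here is a statement of any
manuscript; AI-produced, gate-checked, weaker than expert review.]
-/

set_option linter.dupNamespace false -- mandated namespace of this single-conjunct summit

noncomputable section

namespace Summit.ResolutionOfSingularities.ResolutionOfSingularities.Theorems

namespace TameFourTupleDrop

open MvPowerSeries Literature.AlgebraicGeometry.Resolution PolyDescent

/-- **`stub_regimePresented` FROM THE EXISTENTIAL BUDGET** (the v35 registered text of `stub_conflictBudget` as the only hypothesis). -/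
theorem stub_regimePresented_of_budgetEx
    (hB : ∀ (p : ℕ), p.Prime → ∀ (k : Type) [Field k] [CharP k p] [IsAlgClosed k],
      ∃ M : (d : ℕ) → (Fin d → MvPowerSeries (Fin 2) k) → Finset (Fin 2) → ℕ,
        (∀ (d : ℕ) (A : Fin d → MvPowerSeries (Fin 2) k) (N : Finset (Fin 2)) (A' : Fin d → MvPowerSeries (Fin 2) k) (N' : Finset (Fin 2)),
          (∃ (b : MvPowerSeries (Fin 3) k) (δ : Decoration k 2) (Θ : Fin 3 → MvPowerSeries (Fin 3) k),
            Admissible b δ ∧ 2 ≤ δ.o ∧ δ.c = d ∧ δ.PresBy d A N Θ) →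
          InPoly d A → InPoly d A' → SuccFamilySel d (prepSelWP d) A N A' N' → M d A' N' ≤ M d A N) ∧
        (∀ (d : ℕ) (A : Fin d → MvPowerSeries (Fin 2) k) (N : Finset (Fin 2)) (A' : Fin d → MvPowerSeries (Fin 2) k) (N' : Finset (Fin 2)),
          (∃ (b : MvPowerSeries (Fin 3) k) (δ : Decoration k 2) (Θ : Fin 3 → MvPowerSeries (Fin 3) k),
            Admissible b δ ∧ 2 ≤ δ.o ∧ δ.c = d ∧ δ.PresBy d A N Θ) →
          InPoly d A → InPoly d A' → NCPoly.Conflict d A N → PointFamilySel d (prepSelWP d) A N A' N' → M d A' N' < M d A N)) :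
    ∀ (p : ℕ), p.Prime → ∀ (k : Type) [Field k] [CharP k p] [IsAlgClosed k],
      ∀ (b : MvPowerSeries (Fin 3) k) (δ : TameFourTupleDrop.Decoration k 2), TameFourTupleDrop.Admissible b δ → 2 ≤ δ.o → ¬ δ.HCol →
        (δ.O.Nonempty ∨ δ.GoodDir) →
        TameFourTupleDrop.DWinsTo (St := MvPowerSeries (Fin 3) k × TameFourTupleDrop.Decoration k 2) Prod.fst
          (fun τ => TameFourTupleDrop.Admissible τ.1 τ.2 ∧ (τ.2.head < δ.head ∨ (τ.2.head = δ.head ∧ τ.2.HCol))) (b, δ) := by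
  intro p hp k _ _ _ b δ hadm ho hnc hreg
  obtain ⟨M, hM_succ, hM_conf⟩ := hB p hp k
  exact regimePresented_of_budget M hM_succ hM_conf b δ hadm ho hnc hreg

/-- **`stub_regimeLetter` FROM THE EXISTENTIAL BUDGET.** -/
theorem stub_regimeLetter_of_budgetEx
    (hB : ∀ (p : ℕ), p.Prime → ∀ (k : Type) [Field k] [CharP k p] [IsAlgClosed k],
      ∃ M : (d : ℕ) → (Fin d → MvPowerSeries (Fin 2) k) → Finset (Fin 2) → ℕ,
        (∀ (d : ℕ) (A : Fin d → MvPowerSeries (Fin 2) k) (N : Finset (Fin 2)) (A' : Fin d → MvPowerSeries (Fin 2) k) (N' : Finset (Fin 2)),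
          (∃ (b : MvPowerSeries (Fin 3) k) (δ : Decoration k 2) (Θ : Fin 3 → MvPowerSeries (Fin 3) k),
            Admissible b δ ∧ 2 ≤ δ.o ∧ δ.c = d ∧ δ.PresBy d A N Θ) →
          InPoly d A → InPoly d A' → SuccFamilySel d (prepSelWP d) A N A' N' → M d A' N' ≤ M d A N) ∧
        (∀ (d : ℕ) (A : Fin d → MvPowerSeries (Fin 2) k) (N : Finset (Fin 2)) (A' : Fin d → MvPowerSeries (Fin 2) k) (N' : Finset (Fin 2)),
          (∃ (b : MvPowerSeries (Fin 3) k) (δ : Decoration k 2) (Θ : Fin 3 → MvPowerSeries (Fin 3) k),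
            Admissible b δ ∧ 2 ≤ δ.o ∧ δ.c = d ∧ δ.PresBy d A N Θ) →
          InPoly d A → InPoly d A' → NCPoly.Conflict d A N → PointFamilySel d (prepSelWP d) A N A' N' → M d A' N' < M d A N)) :
    ∀ (p : ℕ), p.Prime → ∀ (k : Type) [Field k] [CharP k p] [IsAlgClosed k],
      ∀ (b : MvPowerSeries (Fin 3) k) (δ : TameFourTupleDrop.Decoration k 2) (l : Fin 3), TameFourTupleDrop.Admissible b δ → 2 ≤ δ.o →
        ¬ δ.HCol → δ.LetterDir l →
        TameFourTupleDrop.DWinsTo (St := MvPowerSeries (Fin 3) k × TameFourTupleDrop.Decoration k 2) Prod.fst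
          (fun τ => TameFourTupleDrop.Admissible τ.1 τ.2 ∧
            (τ.2.head < δ.head ∨ (τ.2.head = δ.head ∧ (τ.2.HCol ∨ τ.2.GoodDir ∨ τ.2.BadDir)))) (b, δ) := by
  intro p hp k _ _ _ b δ l hadm ho _ hl
  obtain ⟨M, hM_succ, hM_conf⟩ := hB p hp k
  exact regimeLetter_of_budget M hM_succ hM_conf b δ hadm ho hl

end TameFourTupleDrop

end Summit.ResolutionOfSingularities.ResolutionOfSingularities.Theorems

end
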